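import Literature.NumberTheory.Rogawski1990.LocalTransferCompactSideJunctionCM       -- ★ p842024 B-p08 (g27): the `hI′` payer (+ ★ p841647 the (R-inv) junction, (R2))
import Literature.NumberTheory.Rogawski1990.LocalTransferCentralSingularDescentCM        -- ★ p842098 A-p14 (g27): the `hD` fold (Harish-Chandra descent, B4 chain)
import Literature.NumberTheory.Rogawski1990.LocalEndoscopicDockSeparation               -- ★ p841863 F0P3-p01 (g12): `hsep′`
import Literature.NumberTheory.Rogawski1990.FinExplicitTransferFactorDockConstancy       -- ★ p841696 F0P3-p01 (g12): `hΔθ`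
import Literature.NumberTheory.Rogawski1990.LocalNormFibreBlockDichotomyDock             -- ★ p841689 p08 (g13): `side_of_dock`, `disj_of_dock` (`hside`, `hdisj`)
import HarnessLib

/-!
# THE S1 DRESS: `R_φ` IS A LOCAL STABLE ORBITAL INTEGRAL AT THE CENTRAL `(G,H)`-REGULAR POINT `ε_H = (a·1₂, u)` — `stub_N6nsS1` of the line «N6nsGerm»
# ⟸ the (R-inv) junction ★ p841647 with EVERY ε-side binder PAID BY NAME, the compact (`ε′`) side threaded through ★ p842024 (Rogawski 1990, Prop. 8.2.1 (a)(d) ⟸ 8.1.3)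

Topic `NumberTheory/Rogawski1990`; namespace `Literature.NumberTheory.Rogawski1990`.  ONE THEOREM (+ two private one-liners), no definition, no instance, no
notation, no named fact, no `sorry`.  Cell `pub/hodgecm-mathlib` (D-0151), crux H413 = stmt-HodgeConjecture-24833, floor-2 line «N6nsGerm»
(`Cruxes/H413/Lines/F0_P3a_N6nsGerm.lean`, stub `stub_N6nsS1` :115–:153); LEAD F0P3a-plan (g9) WORD T8-128 (1); census = A-p14 (g27)'s
`CENSUS-S1dress-CentralSingularAssembly.A-p14g27.md` c1739bdf §4 VERBATIM (defaults (Q) `Q′ :=` p08's frame token with dock + frames as DATA, (C) the compact dock `C′`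
ABSTRACT, (q3) `hΔ′` a hypothesis; pen F0P2-p02 (g8) «=» 07:12:56Z∕07:13:25Z); seat A-p16 (g26).

THE STATEMENT.  The binders of `stub_N6nsS1` in its order and tokens (`μ`, `H′` hermitian anisotropic, `v` with ONE place above it, the measurable-space families, Haar
measures, CANONICAL orbital-measure families `mH`, `mG`, `φ ∈ C_c^∞(G′_v)`, `ε_H = (a·1₂, u)` with `u ≠ a`), THEN the data the closer obtains by two `obtain`s — the central dock
`(ε, y, θ, hθε, hθ)` (★ `exists_centralDock_of_fst_eq_smul_one`) and the bad frame `(W, G₁, G₂, P′, G₁′, G₂′, hPW, hP′, hnn)` (★ `exists_badFrame_dock`) —, THEN the abstract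
compact dock `C′` at the second class with its canonical family, and LAST the four residual hypotheses of ★ p842024 with `Q′ := fun γH g => ∃ B, g·P′ = P′·(B ⊕ᶠ u(γH))`
β-reduced: `hD′` ((D2ε′)+(sat′), A-p17), `hΔ′` ((Δ-θ′)), `hcnt` ((CNT), p08∕B-p04), `hR2 : RankOneEulerPoincareNonsplit` (★ named fact).  CONCLUSION = the body of `stub_N6nsS1`
VERBATIM: `∃ V ∈ 𝓝 ε_H, ∃ φ^H ∈ C_c^∞(H_v), ∀ γ_H ∈ V G-regular, Φ^st_H(γ_H, φ^H) = Σᶠ_c Δ‴_v(γ_H, c)·Φ(c, φ)`.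
PROOF = ONE application of ★ `exists_nhds_stableOrbitalIntegralRel_eq_of_central_singular_inv` (p841647) with `hsep′ :=` ★ p841863, `hside`∕`hdisj :=` ★ `side_of_dock`∕`disj_of_dock`
(on `univ`), `hD :=` ★ p842098, `hΔθ :=` ★ p841696, `hI′ :=` ★ p842024; `w ∣ v` from ★ `PlacesOver.nonempty`, `w̄ = w` from `Subsingleton`, `det H′ ≠ 0` from anisotropy.
After this file `stub_N6nsS1` ⇐ {(D2ε′)+(sat′), (Δ-θ′), (CNT), (R2)} and NOTHING ELSE.

* **`exists_nhds_stableOrbitalIntegralRel_eq_of_central_singular_of_compactSide`**.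

HONEST LABEL.  HC_CM is proved only modulo the printed citations until rung 0 closes; this file is an ASSEMBLY (no new mathematics) and is hypothesis-driven on its four residual binders.

## References
* [Rogawski1990] J. D. Rogawski, *Automorphic Representations of Unitary Groups in Three Variables*, Ann. of Math. Stud. 123 (1990): §8.2 Prop. 8.2.1 (a)(d) pp. 112–113; §8.1
  Prop. 8.1.3 pp. 110–111; §4.3 (4.3.1) p. 43; §4.9 p. 56.
* [LanglandsShelstad1990Descent] R. P. Langlands, D. Shelstad, *Descent for transfer factors*, The Grothendieck Festschrift II (1990): Thm. 2.3.A, §2.4.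
-/

set_option autoImplicit false

noncomputable section

open Set Filter Topology MeasureTheory Measure NumberField IsDedekindDomain
open scoped Matrix MatrixGroups

namespace Literature.NumberTheory.Rogawski1990

open Literature.NumberTheory.Automorphic Literature.NumberTheory.Automorphic.UnitaryGroup Literature.NumberTheory.GaloisRepresentations

section S1Dress

/-- `H′` anisotropic ⇒ `det H′ ≠ 0` (a kernel vector is isotropic). Local copy of ★ `det_ne_zero_of_anisotropic`. [cite: Rogawski1990, §4.9 p. 54] -/
private theorem det_ne_zero_of_anisotropic₆ {L : Type} [Field L] [NumberField L] [IsCMField L] {H : Matrix (Fin 3) (Fin 3) L}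
    (hH0 : ∀ x : Fin 3 → L, Literature.AlgebraicGeometry.ShimuraVarieties.hermForm (cmConjRingHom L) H x x = 0 → x = 0) : H.det ≠ 0 := by
  intro hdet
  obtain ⟨x, hx, hHx⟩ := Matrix.exists_mulVec_eq_zero_iff.mpr hdet
  refine hx (hH0 x ?_)
  rw [Literature.AlgebraicGeometry.ShimuraVarieties.hermForm, hHx, dotProduct_zero]

/-- At a place with ONE prime of `L` above it, that prime is fixed by complex conjugation (local copy of ★ `smul_eq_of_subsingleton_placesOver`).
[cite: CasselsFrohlichANT1967, Ch. VII Prop. 1.2 (ii)] -/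
private theorem smul_eq_of_subsingleton_placesOver₃ (L : Type) [Field L] [NumberField L] [IsCMField L] {v : HeightOneSpectrum (𝓞 ↥(maximalRealSubfield L))}
    (hv : Subsingleton (PlacesOver L v)) (w : PlacesOver L v) : IsCMField.complexConj L • w.1 = w.1 := by
  have hmem : (IsCMField.complexConj L • w.1).under (𝓞 ↥(maximalRealSubfield L)) = v := by
    rw [HeightOneSpectrum.under_algEquiv_smul]; exact w.2
  exact congrArg Subtype.val (Subsingleton.elim (⟨IsCMField.complexConj L • w.1, hmem⟩ : PlacesOver L v) w)

/-- **THE S1 DRESS — `R_φ` IS A LOCAL STABLE ORBITAL INTEGRAL AT `ε_H = (a·1₂, u)` (`u ≠ a`), modulo (D2ε′)+(sat′), (Δ-θ′), (CNT), (R2).**  See the module docstring: the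
binders of `stub_N6nsS1`, then the dock and frame data, then the abstract compact dock at the second class, then the four residual hypotheses of ★
`exists_nhds_finsum_side_eq_stableOrbitalIntegralRel_of_compact_dock`; the conclusion is `stub_N6nsS1`'s body.  One application of ★
`exists_nhds_stableOrbitalIntegralRel_eq_of_central_singular_inv`.
[cite: Rogawski1990, §8.2 Prop. 8.2.1 (a)(d) pp. 112–113; §8.1 Prop. 8.1.3 pp. 110–111; §4.3 (4.3.1) p. 43] [cite: LanglandsShelstad1990Descent, Thm. 2.3.A, §2.4] -/
theorem exists_nhds_stableOrbitalIntegralRel_eq_of_central_singular_of_compactSide (L : Type) [Field L] [NumberField L] [IsCMField L] (H' : Matrix (Fin 3) (Fin 3) L)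
    (μ : HeckeCharacter L) (hherm : (H'.map (cmConjRingHom L)).transpose = H')
    (hanis : ∀ x : Fin 3 → L, Literature.AlgebraicGeometry.ShimuraVarieties.hermForm (cmConjRingHom L) H' x x = 0 → x = 0)
    (v : HeightOneSpectrum (𝓞 ↥(maximalRealSubfield L))) (hv : Subsingleton (PlacesOver L v))
    [MeasurableSpace ((cmDatum L 2 (Matrix.of fun i j : Fin 2 => if i.val + j.val + 1 = 2 then (1 : L) else 0)).Local v ×
      (cmDatum L 1 (Matrix.of fun i j : Fin 1 => if i.val + j.val + 1 = 1 then (1 : L) else 0)).Local v)] [BorelSpace ((cmDatum L 2 (Matrix.of fun i j : Fin 2 => if i.val + j.val + 1 = 2 then (1 : L) else 0)).Local v ×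
      (cmDatum L 1 (Matrix.of fun i j : Fin 1 => if i.val + j.val + 1 = 1 then (1 : L) else 0)).Local v)] [MeasurableSpace ((cmDatum L 3 H').Local v)] [BorelSpace ((cmDatum L 3 H').Local v)]
    [iH : ∀ a : ((cmDatum L 2 (Matrix.of fun i j : Fin 2 => if i.val + j.val + 1 = 2 then (1 : L) else 0)).Local v ×
      (cmDatum L 1 (Matrix.of fun i j : Fin 1 => if i.val + j.val + 1 = 1 then (1 : L) else 0)).Local v), MeasurableSpace (((cmDatum L 2 (Matrix.of fun i j : Fin 2 => if i.val + j.val + 1 = 2 then (1 : L) else 0)).Local v ×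
        (cmDatum L 1 (Matrix.of fun i j : Fin 1 => if i.val + j.val + 1 = 1 then (1 : L) else 0)).Local v) ⧸
        Subgroup.centralizer ({a} : Set ((cmDatum L 2 (Matrix.of fun i j : Fin 2 => if i.val + j.val + 1 = 2 then (1 : L) else 0)).Local v ×
          (cmDatum L 1 (Matrix.of fun i j : Fin 1 => if i.val + j.val + 1 = 1 then (1 : L) else 0)).Local v)))]
    [bH : ∀ a : ((cmDatum L 2 (Matrix.of fun i j : Fin 2 => if i.val + j.val + 1 = 2 then (1 : L) else 0)).Local v ×
      (cmDatum L 1 (Matrix.of fun i j : Fin 1 => if i.val + j.val + 1 = 1 then (1 : L) else 0)).Local v), BorelSpace (((cmDatum L 2 (Matrix.of fun i j : Fin 2 => if i.val + j.val + 1 = 2 then (1 : L) else 0)).Local v ×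
        (cmDatum L 1 (Matrix.of fun i j : Fin 1 => if i.val + j.val + 1 = 1 then (1 : L) else 0)).Local v) ⧸
        Subgroup.centralizer ({a} : Set ((cmDatum L 2 (Matrix.of fun i j : Fin 2 => if i.val + j.val + 1 = 2 then (1 : L) else 0)).Local v ×
          (cmDatum L 1 (Matrix.of fun i j : Fin 1 => if i.val + j.val + 1 = 1 then (1 : L) else 0)).Local v)))]
    [iG : ∀ γ : ((cmDatum L 3 H').Local v), MeasurableSpace (((cmDatum L 3 H').Local v) ⧸ Subgroup.centralizer ({γ} : Set ((cmDatum L 3 H').Local v)))]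
    [bG : ∀ γ : ((cmDatum L 3 H').Local v), BorelSpace (((cmDatum L 3 H').Local v) ⧸ Subgroup.centralizer ({γ} : Set ((cmDatum L 3 H').Local v)))]
    (νH : Measure ((cmDatum L 2 (Matrix.of fun i j : Fin 2 => if i.val + j.val + 1 = 2 then (1 : L) else 0)).Local v ×
      (cmDatum L 1 (Matrix.of fun i j : Fin 1 => if i.val + j.val + 1 = 1 then (1 : L) else 0)).Local v)) [νH.IsHaarMeasure] [νH.IsMulRightInvariant]
    (νG : Measure ((cmDatum L 3 H').Local v)) [νG.IsHaarMeasure] [νG.IsMulRightInvariant]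
    (mH : OrbitalMeasureFamily ((cmDatum L 2 (Matrix.of fun i j : Fin 2 => if i.val + j.val + 1 = 2 then (1 : L) else 0)).Local v ×
      (cmDatum L 1 (Matrix.of fun i j : Fin 1 => if i.val + j.val + 1 = 1 then (1 : L) else 0)).Local v)) (mG : OrbitalMeasureFamily ((cmDatum L 3 H').Local v))
    (hmH : mH.IsCanonical (IsLocalGRegular L v) νH)
    (hmG : mG.IsCanonical (fun γ : ((cmDatum L 3 H').Local v) => IsRegularElt (γ.val : GL (Fin 3) (LocalRing L v))) νG)
    (φ : ((cmDatum L 3 H').Local v) → ℂ) (hφ : IsLocSmooth φ)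
    (εH : ((cmDatum L 2 (Matrix.of fun i j : Fin 2 => if i.val + j.val + 1 = 2 then (1 : L) else 0)).Local v ×
      (cmDatum L 1 (Matrix.of fun i j : Fin 1 => if i.val + j.val + 1 = 1 then (1 : L) else 0)).Local v)) (a : LocalRing L v)
    (ha : (εH.1.val.val : Matrix (Fin 2) (Fin 2) (LocalRing L v)) = a • (1 : Matrix (Fin 2) (Fin 2) (LocalRing L v)))
    (hu : (εH.2.val.val : Matrix (Fin 1) (Fin 1) (LocalRing L v)) 0 0 ≠ a)
    -- the central dock (★ `exists_centralDock_of_fst_eq_smul_one`)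
    (ε : ((cmDatum L 3 H').Local v)) (y : GL (Fin 3) (LocalRing L v)) (θ : ((cmDatum L 2 (Matrix.of fun i j : Fin 2 => if i.val + j.val + 1 = 2 then (1 : L) else 0)).Local v ×
      (cmDatum L 1 (Matrix.of fun i j : Fin 1 => if i.val + j.val + 1 = 1 then (1 : L) else 0)).Local v) ≃ₜ* ↥(Subgroup.centralizer ({ε} : Set ((cmDatum L 3 H').Local v)))) (hθε : (θ εH).1 = ε)
    (hθ : ∀ z : ((cmDatum L 2 (Matrix.of fun i j : Fin 2 => if i.val + j.val + 1 = 2 then (1 : L) else 0)).Local v ×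
      (cmDatum L 1 (Matrix.of fun i j : Fin 1 => if i.val + j.val + 1 = 1 then (1 : L) else 0)).Local v), (((θ z).1).val : GL (Fin 3) (LocalRing L v)) = y * ((endoEmbLocal L v z).val : GL (Fin 3) (LocalRing L v)) * y⁻¹)
    -- the bad frame (★ `exists_badFrame_dock`)
    {W : GL (Fin 3) (LocalRing L v)} (hW : W.val = !![(1 : LocalRing L v), 0, 0; 0, 0, 1; 0, 1, 0])
    {G₁ G₁' : Matrix (Fin 2) (Fin 2) (LocalRing L v)} {G₂ G₂' : Matrix (Fin 1) (Fin 1) (LocalRing L v)} {P' : GL (Fin (2 + 1)) (LocalRing L v)}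
    (hPW : twistGram (conjLocal L (IsCMField.complexConj L) v) ((adelicForm L 3 H').map (adeleToLocal L v)) (y * W).val = finSum 2 1 G₁ G₂)
    (hP' : twistGram (conjLocal L (IsCMField.complexConj L) v) ((adelicForm L 3 H').map (adeleToLocal L v)) P'.val = finSum 2 1 G₁' G₂')
    (hnn : ¬ ∃ z : LocalRing L v, IsUnit z ∧ G₁'.det = G₁.det * (conjLocal L (IsCMField.complexConj L) v z * z))
    -- the compact dock at the second class (abstract)
    (C' : Type) [Group C'] [TopologicalSpace C'] [IsTopologicalGroup C'] [CompactSpace C'] [LocallyCompactSpace C'] [SecondCountableTopology C'] [T2Space C']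
    [MeasurableSpace C'] [BorelSpace C']
    [∀ m : C', MeasurableSpace (C' ⧸ Subgroup.centralizer ({m} : Set C'))] [∀ m : C', BorelSpace (C' ⧸ Subgroup.centralizer ({m} : Set C'))]
    (ν' : Measure C') [ν'.IsHaarMeasure] [ν'.IsMulRightInvariant] (P'' : C' → Prop) {m' : OrbitalMeasureFamily C'} (hm' : m'.IsCanonical P'' ν') (εC : C')
    -- (D2ε′)+(sat′): DESCENT at the second class read on `C′`, with compact-side saturation
    (hD' : ∀ ψ : ((cmDatum L 3 H').Local v) → ℂ, IsLocSmooth ψ → ∃ ψε : C' → ℂ, IsLocallyConstant ψε ∧ ∀ B' ∈ 𝓝 εC, ∃ V ∈ 𝓝 εH, ∀ γH ∈ V, IsLocalGRegular L v γH →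
        ∀ c : ConjClasses ((cmDatum L 3 H').Local v), (∃ x : ((cmDatum L 3 H').Local v), (∃ B : Matrix (Fin 2) (Fin 2) (LocalRing L v), ((x * Quotient.out c * x⁻¹).val.val : Matrix (Fin 3) (Fin 3) (LocalRing L v)) * P'.val = P'.val * finSum 2 1 B (γH.2.val.val : Matrix (Fin 1) (Fin 1) (LocalRing L v)))) → IsLocalNormPair L H' v γH (Quotient.out c) →
          ∃ m ∈ B', P'' (Quotient.out (ConjClasses.mk m)) ∧ classOrbitalIntegral mG ψ c = classOrbitalIntegral m' ψε (ConjClasses.mk m))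
    -- (Δ-θ′): `Δ‴_v` is constant on the matched `Q′`-side classes near `ε_H`
    (hΔ' : ∃ Δ₁ : ℂ, ∃ VΔ ∈ 𝓝 εH, ∀ γH ∈ VΔ, IsLocalGRegular L v γH → ∀ c : ConjClasses ((cmDatum L 3 H').Local v), (∃ x : ((cmDatum L 3 H').Local v), (∃ B : Matrix (Fin 2) (Fin 2) (LocalRing L v), ((x * Quotient.out c * x⁻¹).val.val : Matrix (Fin 3) (Fin 3) (LocalRing L v)) * P'.val = P'.val * finSum 2 1 B (γH.2.val.val : Matrix (Fin 1) (Fin 1) (LocalRing L v)))) →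
        IsLocalNormPair L H' v γH (Quotient.out c) → ((finExplicitCollection L H' μ (finExplicitDelta_conj_left_all L H' μ) (finExplicitDelta_conj_right_all L H' μ)) v).Δ γH (Quotient.out c) = Δ₁)
    -- (CNT): the matched `Q′`-side classes are as many as the stable class of `γ_H` in `H_v` if `Z(γ_H.1)` is compact, none otherwise
    (hcnt : ∃ Vc ∈ 𝓝 εH, ∀ γH ∈ Vc, IsLocalGRegular L v γH →
        {c : ConjClasses ((cmDatum L 3 H').Local v) | (∃ x : ((cmDatum L 3 H').Local v), (∃ B : Matrix (Fin 2) (Fin 2) (LocalRing L v), ((x * Quotient.out c * x⁻¹).val.val : Matrix (Fin 3) (Fin 3) (LocalRing L v)) * P'.val = P'.val * finSum 2 1 B (γH.2.val.val : Matrix (Fin 1) (Fin 1) (LocalRing L v)))) ∧ IsLocalNormPair L H' v γH (Quotient.out c)}.Finite ∧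
        {d : ConjClasses (((cmDatum L 2 (Matrix.of fun i j : Fin 2 => if i.val + j.val + 1 = 2 then (1 : L) else 0)).Local v) ×
      ((cmDatum L 1 (Matrix.of fun i j : Fin 1 => if i.val + j.val + 1 = 1 then (1 : L) else 0)).Local v)) | IsLocalStablyConjH L v γH (Quotient.out d)}.Finite ∧
        (CompactSpace (Subgroup.centralizer ({γH.1} : Set ((cmDatum L 2 (Matrix.of fun i j : Fin 2 => if i.val + j.val + 1 = 2 then (1 : L) else 0)).Local v))) →
          {c : ConjClasses ((cmDatum L 3 H').Local v) | (∃ x : ((cmDatum L 3 H').Local v), (∃ B : Matrix (Fin 2) (Fin 2) (LocalRing L v), ((x * Quotient.out c * x⁻¹).val.val : Matrix (Fin 3) (Fin 3) (LocalRing L v)) * P'.val = P'.val * finSum 2 1 B (γH.2.val.val : Matrix (Fin 1) (Fin 1) (LocalRing L v)))) ∧ IsLocalNormPair L H' v γH (Quotient.out c)}.ncard =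
            {d : ConjClasses (((cmDatum L 2 (Matrix.of fun i j : Fin 2 => if i.val + j.val + 1 = 2 then (1 : L) else 0)).Local v) ×
      ((cmDatum L 1 (Matrix.of fun i j : Fin 1 => if i.val + j.val + 1 = 1 then (1 : L) else 0)).Local v)) | IsLocalStablyConjH L v γH (Quotient.out d)}.ncard) ∧
        (¬ CompactSpace (Subgroup.centralizer ({γH.1} : Set ((cmDatum L 2 (Matrix.of fun i j : Fin 2 => if i.val + j.val + 1 = 2 then (1 : L) else 0)).Local v))) →
          ∀ c : ConjClasses ((cmDatum L 3 H').Local v), (∃ x : ((cmDatum L 3 H').Local v), (∃ B : Matrix (Fin 2) (Fin 2) (LocalRing L v), ((x * Quotient.out c * x⁻¹).val.val : Matrix (Fin 3) (Fin 3) (LocalRing L v)) * P'.val = P'.val * finSum 2 1 B (γH.2.val.val : Matrix (Fin 1) (Fin 1) (LocalRing L v)))) → ¬ IsLocalNormPair L H' v γH (Quotient.out c)))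
    -- (R2) the named fact
    (hR2 : RankOneEulerPoincareNonsplit) :
    ∃ V ∈ 𝓝 εH, ∃ φH : ((cmDatum L 2 (Matrix.of fun i j : Fin 2 => if i.val + j.val + 1 = 2 then (1 : L) else 0)).Local v ×
      (cmDatum L 1 (Matrix.of fun i j : Fin 1 => if i.val + j.val + 1 = 1 then (1 : L) else 0)).Local v) → ℂ, IsLocSmooth φH ∧
      ∀ γH ∈ V, IsLocalGRegular L v γH →
        stableOrbitalIntegralRel (IsLocalStablyConjH L v) mH φH γH =
          ∑ᶠ c : ConjClasses ((cmDatum L 3 H').Local v), ((finExplicitCollection L H' μ (finExplicitDelta_conj_left_all L H' μ) (finExplicitDelta_conj_right_all L H' μ)) v).Δ γH (Quotient.out c) * classOrbitalIntegral mG φ c := by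
  -- the place above `v`, its conjugation-invariance, `det H′ ≠ 0`, the dock read as `y ι(ε_H) y⁻¹ = ε`
  obtain ⟨w⟩ := PlacesOver.nonempty L v
  have hw : IsCMField.complexConj L • w.1 = w.1 := smul_eq_of_subsingleton_placesOver₃ L hv w
  have hdet' : H'.det ≠ 0 := det_ne_zero_of_anisotropic₆ hanis
  have hy : y * ((endoEmbLocal L v εH).val : GL (Fin 3) (LocalRing L v)) * y⁻¹ = ε.val := by
    rw [← hθ εH, hθε]
  -- ONE application of the (R-inv) junction
  exact exists_nhds_stableOrbitalIntegralRel_eq_of_central_singular_inv L H' v hherm hdet' μ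
    (finExplicitDelta_conj_left_all L H' μ) (finExplicitDelta_conj_right_all L H' μ) νH hmH εH ε y θ hθ
    (fun γH g => ∃ B : Matrix (Fin 2) (Fin 2) (LocalRing L v),
      (g.val.val : Matrix (Fin 3) (Fin 3) (LocalRing L v)) * P'.val = P'.val * finSum 2 1 B (γH.2.val.val : Matrix (Fin 1) (Fin 1) (LocalRing L v)))
    (exists_nhds_stablySaturated_sep_dock w hw εH a ha hu ε y θ hy hθ)
    ⟨univ, univ_mem, fun γH _ hreg γ' hm => side_of_dock L H' v w hw hherm hdet' εH a ha θ hθ hW hy hPW hP' hnn γH hreg γ' hm⟩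
    ⟨univ, univ_mem, fun γH _ hreg γ' hε hε' => disj_of_dock L H' v θ hθ hW hPW hP' hnn γH hreg γ' hε hε'⟩
    (fun ψ hψ => exists_nhds_classOrbitalIntegral_dock_eq_of_isLocSmooth L H' v hherm hdet' w hw νH νG hmH hmG εH a ha hu ε y θ hθε hθ ψ hψ)
    (exists_nhds_finExplicitDelta_dock_eq w hw μ εH a ha hu ε y θ hy hθ)
    (exists_nhds_finsum_side_eq_stableOrbitalIntegralRel_of_compact_dock L H' v hv μ
      (finExplicitDelta_conj_left_all L H' μ) (finExplicitDelta_conj_right_all L H' μ) νH hmH εH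
      (fun γH g => ∃ B : Matrix (Fin 2) (Fin 2) (LocalRing L v),
        (g.val.val : Matrix (Fin 3) (Fin 3) (LocalRing L v)) * P'.val = P'.val * finSum 2 1 B (γH.2.val.val : Matrix (Fin 1) (Fin 1) (LocalRing L v)))
      C' ν' P'' hm' εC hD' hΔ' hcnt hR2)
    φ hφ

end S1Dress

end Literature.NumberTheory.Rogawski1990
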